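import Summits.BirchSwinnertonDyer.BirchSwinnertonDyer.Theorems.ManinLocalTwoThreeThreeBlindVeluAscent
import Summits.BirchSwinnertonDyer.BirchSwinnertonDyer.Theorems.ManinLocalTwoThreeShimuraDefectLawAtThree
import Literature.NumberTheory.Automorphic.ShimuraCurveRibetTakahashiOptimalProofs
import HarnessLib

/-!
# The converse of (VÉLU₃♯): if the Vélu `3`-quotient by a rational `3`-torsion point ASCENDS, the point satisfies the
# `z⁹` congruence `Y₁ ≡ 4(α/3)³ (mod 9)` — so «ascends ⟺ congruent», and an untripled index-`3` Shimura kernel with a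
# RATIONAL generator is congruent

Summit `BirchSwinnertonDyer`, route `ManinLocalTwoThree` (cell bsd-f2-manin), crux C3 `ManinPrimeToThreeAtNine`
(stmt-BirchSwinnertonDyer-22968); lead p1 gen 14; the `3`-adic twin of `…VeluDescentBlind` (p = 2, this gen).  Setting of
`…ThreeBlindVeluAscent` (p3/lead): `W/ℚ` with `3`-integral `a₄♮, a₆♮` (automatic at a datum of level `9 ∣ N`), a rational point
`T = (X₁, Y₁)` of order `3` on `E♮ = E_{W,1}`, flex slope `α` (`α² = 3X₁`, `3 ∣ α`), `σ = α/3`, and the Vélu pair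
`(A, B) = (1440X₁² − 9c₄(W), 60480X₁³ − 756c₄(W)X₁ − 27c₆(W))`.  The tree has «congruent ⟹ ascends» (§3 there:
some globally minimal `W'` carries `(3⁻⁴A, 3⁻⁶B)`).  THIS FILE proves the converse:

* `norm_congruence_le_one_of_velu_three_ascends` — **if a globally minimal `W'` has `3⁴c₄(W') = A`, `3⁶c₆(W') = B`, then
  `9 ∣ Y₁ − 4σ³` in `ℤ₃`.**  In the chart `c₄(W') = 16σ(σ³ + 2Y₁)`, `c₆(W') = 32((Y₁ + 5σ³)² − 27σ⁶)`,
  `Δ(W') = 16Y₁D³/27` with `D = 4σ³ − Y₁`.  If `ord₃ D = 0`, integrality of `Δ(W')` gives `27 ∣ Y₁` and then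
  `⟨3; X₁, α, Y₁⟩ • E♮ = [2σ, 0, 2Y₁/27, 0, 0]` is a `3`-integral model of `W` with discriminant `3⁻¹²Δ(W)` — impossible for the
  globally minimal `W` (`padicValInt_minimalDiscriminantInt_le_padicValRat_Δ_smul_of_norm_le_one`); if `ord₃ D = 1`, then
  `ord₃(Y₁ + 5σ³) = ord₃(9σ³ − D) = 1` and `ord₃ c₆(W') = 2`, which Kraus' condition at `3` forbids for the INTEGRAL `W'`
  (`twentyseven_dvd_c₆_of_three_dvd`: on an integral model `3 ∣ c₆ ⟹ 27 ∣ c₆`).  Hence `ord₃ D ≥ 2`.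
* `norm_congruence_le_one_of_velu_three_ascends_of_nine_dvd` — the same at a datum of level `9 ∣ N`.
* `norm_congruence_le_one_of_untripled_index_three` — **ledger corollary** (with `velu_three_ascends_at_of_natAbs_eq`, p714388):
  for the optimal pair at `9 ∣ N` with `|c₀| = |c₁|`, `Λ₁(f) ≠ Λ₀(f)`, if the kernel abscissa `℘(c₀w/3)` is the `X`-coordinate of
  a RATIONAL `3`-torsion point `(X₁, Y₁)` of `E♮`, that point is congruent (`9 ∣ Y₁ − 4σ³`).

HONEST FRAMING: local algebra at `3` and lattice bookkeeping; NB₃ / NB₃^V stay OPEN; no Manin constant is decided; C3, Manin's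
conjecture and BSD are not proved.  No definitions, no named facts, no sorry.
-/

set_option autoImplicit false
-- the summit-side namespace `Summit.BirchSwinnertonDyer.BirchSwinnertonDyer.…` is the tree's (summit = sub-problem)
set_option linter.dupNamespace false

noncomputable section

open scoped Classical
open WeierstrassCurve Literature.NumberTheory.EllipticCurves Literature.NumberTheory.EllipticCurves.ModularForms
open CongruenceSubgroup Polynomial
open Summit.BirchSwinnertonDyer.Rank1Residual.ManinAdditive.CuspidalKummer
open Summit.BirchSwinnertonDyer.Rank1Residual.ManinAdditive.CuspidalKummerThree

namespace Summit.BirchSwinnertonDyer.BirchSwinnertonDyer.Theorems.ManinLocalTwoThree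

/-! ## §1 Kraus' necessary condition at `3`, integer form -/

/-- **Kraus at `3` (integer form)**: on a Weierstrass model with integer coefficients, `3 ∣ c₆ ⟹ 27 ∣ c₆`
(`c₆ = −b₂³ + 36b₂b₄ − 216b₆ ≡ −b₂³ (mod 27)` when… precisely: if `3 ∣ b₂` every term is divisible by `27`, and if `3 ∤ b₂` then
`3 ∤ c₆`).  [cite: Kraus1989, Prop. 2 (the necessary condition `v₃(c₆) ≠ 1, 2`)] -/
theorem twentyseven_dvd_c₆_of_three_dvd (M : WeierstrassCurve ℤ) (h3 : (3 : ℤ) ∣ M.c₆) : (27 : ℤ) ∣ M.c₆ := by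
  have hc₆ : M.c₆ = -M.b₂ ^ 3 + 36 * M.b₂ * M.b₄ - 216 * M.b₆ := by simp only [WeierstrassCurve.c₆]
  rcases em ((3 : ℤ) ∣ M.b₂) with ⟨k, hk⟩ | hnd
  · refine ⟨-k ^ 3 + 4 * k * M.b₄ - 8 * M.b₆, ?_⟩
    rw [hc₆, hk]; ring
  · exfalso
    have hb : M.b₂ % 3 = 1 ∨ M.b₂ % 3 = 2 := by omega
    obtain ⟨q, hq⟩ := h3
    rcases hb with hb | hb
    · obtain ⟨j, hj⟩ : ∃ j, M.b₂ = 3 * j + 1 := ⟨M.b₂ / 3, by omega⟩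
      have e : M.c₆ = 3 * (-(9 * j ^ 3 + 9 * j ^ 2 + 3 * j) + 12 * (3 * j + 1) * M.b₄ - 72 * M.b₆) - 1 := by
        rw [hc₆, hj]; ring
      omega
    · obtain ⟨j, hj⟩ : ∃ j, M.b₂ = 3 * j + 2 := ⟨M.b₂ / 3, by omega⟩
      have e : M.c₆ = 3 * (-(9 * j ^ 3 + 18 * j ^ 2 + 12 * j) + 12 * (3 * j + 2) * M.b₄ - 72 * M.b₆) - 8 := by
        rw [hc₆, hj]; ring
      omega

/-- For a globally minimal `W'/ℚ`: `‖c₆(W')‖₃ = 1` or `‖c₆(W')‖₃ ≤ 3⁻³` (Kraus at `3` on its integral model). -/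
theorem norm_c₆_eq_one_or_le_of_isGloballyMinimal (W' : WeierstrassCurve ℚ) [W'.IsGloballyMinimal] :
    ‖((W'.c₆ : ℚ) : ℚ_[3])‖ = 1 ∨ ‖((W'.c₆ : ℚ) : ℚ_[3])‖ ≤ 3⁻¹ ^ 3 := by
  haveI : Fact (Nat.Prime 3) := ⟨Nat.prime_three⟩
  set M : WeierstrassCurve ℤ := integralModelInt W' with hM
  have hWM : M.map (Int.castRingHom ℚ) = W' := map_integralModelInt W'
  have h6 : W'.c₆ = (M.c₆ : ℚ) := by rw [← hWM, map_c₆, eq_intCast]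
  have hcast : ((W'.c₆ : ℚ) : ℚ_[3]) = ((M.c₆ : ℤ) : ℚ_[3]) := by rw [h6]; push_cast; rfl
  rw [hcast]
  by_cases h3 : (3 : ℤ) ∣ M.c₆
  · right
    have h27 := twentyseven_dvd_c₆_of_three_dvd M h3
    have h := (Padic.norm_int_le_pow_iff_dvd (p := 3) M.c₆ 3).mpr (by exact_mod_cast h27)
    have e : ((3 : ℕ) : ℝ) ^ (-(3 : ℕ) : ℤ) = 3⁻¹ ^ 3 := by norm_num
    rw [e] at h
    exact h
  · left
    have hle : ‖((M.c₆ : ℤ) : ℚ_[3])‖ ≤ 1 := Padic.norm_int_le_one _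
    have hlt : ¬ ‖((M.c₆ : ℤ) : ℚ_[3])‖ < 1 := fun h ↦ h3 (by exact_mod_cast (Padic.norm_intCast_lt_one_iff).mp h)
    exact le_antisymm hle (not_lt.mp hlt)

/-! ## §2 Ascends ⟹ congruent -/

/-- **The converse of (VÉLU₃♯).**  `W/ℚ` elliptic and globally minimal with `3`-integral `a₄♮, a₆♮`, `T = (X₁, Y₁)` a rational
point of order `3` on `E♮`, `σ = α/3`; if a globally minimal `W'` carries the ASCENDED Vélu pair (`3⁴c₄(W') = 1440X₁² − 9c₄(W)`,
`3⁶c₆(W') = 60480X₁³ − 756c₄(W)X₁ − 27c₆(W)`), then `T` is congruent: `‖(Y₁ − 4σ³)/9‖₃ ≤ 1`.  Proof in the module docstring.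
[cite: SilvermanAEC2009, III.1 Table 3.1 and VII.1] [cite: Kraus1989, Prop. 2] -/
theorem norm_congruence_le_one_of_velu_three_ascends (W : WeierstrassCurve ℚ) [W.IsElliptic] [W.IsGloballyMinimal]
    (hA : ‖(((shortModel W 1).a₄ : ℚ) : ℚ_[3])‖ ≤ 1) (hB : ‖(((shortModel W 1).a₆ : ℚ) : ℚ_[3])‖ ≤ 1)
    {X₁ Y₁ : ℚ} (hT : IsShortThreeTorsion W 1 X₁ Y₁)
    (W' : WeierstrassCurve ℚ) [W'.IsElliptic] [W'.IsGloballyMinimal]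
    (h4 : (3 : ℚ) ^ 4 * W'.c₄ = 1440 * X₁ ^ 2 - 9 * W.c₄)
    (h6 : (3 : ℚ) ^ 6 * W'.c₆ = 60480 * X₁ ^ 3 - 756 * W.c₄ * X₁ - 27 * W.c₆) :
    ‖(((Y₁ - 4 * (tangentSlope W 1 X₁ Y₁ / 3) ^ 3) / 9 : ℚ) : ℚ_[3])‖ ≤ 1 := by
  haveI : Fact (Nat.Prime 3) := ⟨Nat.prime_three⟩
  -- the chart
  obtain ⟨hX, hYn⟩ := norm_le_one_of_isShortThreeTorsion W hA hB hT
  have hs := norm_tangentSlope_div_three_le_one hT hX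
  have hflex := tangentSlope_sq_eq_three_mul hT
  have hY0 := y_ne_zero_of_isShortThreeTorsion hT
  have heq := equation_of_isShortThreeTorsion hT
  obtain ⟨hc4, hc6⟩ := c₄_c₆_eq_of_isShortThreeTorsion W hT
  set α : ℚ := tangentSlope W 1 X₁ Y₁ with hαdef
  set σ : ℚ := α / 3 with hσdef
  have hα : α = 3 * σ := by rw [hσdef]; ring
  have hX₁ : X₁ = 3 * σ ^ 2 := by
    have h : α ^ 2 = 3 * X₁ := hflex
    rw [hα] at h; linear_combination (-(1 : ℚ) / 3) * h
  have hc4σ : W.c₄ = 144 * σ * (9 * σ ^ 3 - 2 * Y₁) := by rw [hc4, hX₁, hα]; ring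
  have hc6σ : W.c₆ = 864 * (-54 * σ ^ 6 + 18 * σ ^ 3 * Y₁ - Y₁ ^ 2) := by rw [hc6, hX₁, hα]; ring
  set D : ℚ := 4 * σ ^ 3 - Y₁ with hDdef
  have hc4' : W'.c₄ = 16 * σ * (σ ^ 3 + 2 * Y₁) := by
    have h := h4; rw [hc4σ, hX₁] at h; linear_combination h / 81
  have hc6' : W'.c₆ = 32 * ((Y₁ + 5 * σ ^ 3) ^ 2 - 27 * σ ^ 6) := by
    have h := h6; rw [hc4σ, hc6σ, hX₁] at h; linear_combination h / 729
  have hΔ' : W'.Δ = 16 * Y₁ * D ^ 3 / 27 := by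
    have h := W'.c_relation
    rw [hc4', hc6'] at h
    rw [hDdef]; linear_combination h / 1728
  have hΔ'0 : W'.Δ ≠ 0 := by rw [← WeierstrassCurve.coe_Δ']; exact W'.Δ'.ne_zero
  have hD0 : D ≠ 0 := by
    intro h; apply hΔ'0; rw [hΔ', h]; ring
  -- norms of numerals in `ℚ₃`
  have hn3 : ‖(3 : ℚ_[3])‖ = 3⁻¹ := by exact_mod_cast Padic.norm_p (p := 3)
  have hnI : ∀ k : ℤ, ¬ (3 : ℤ) ∣ k → ‖((k : ℤ) : ℚ_[3])‖ = 1 := fun k hk ↦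
    le_antisymm (Padic.norm_int_le_one _)
      (not_lt.mp fun h ↦ hk (by exact_mod_cast (Padic.norm_intCast_lt_one_iff).mp h))
  have hn2 : ‖(2 : ℚ_[3])‖ = 1 := by exact_mod_cast hnI 2 (by norm_num)
  have hn4 : ‖(4 : ℚ_[3])‖ = 1 := by exact_mod_cast hnI 4 (by norm_num)
  have hn16 : ‖(16 : ℚ_[3])‖ = 1 := by exact_mod_cast hnI 16 (by norm_num)
  have hn32 : ‖(32 : ℚ_[3])‖ = 1 := by exact_mod_cast hnI 32 (by norm_num)
  have hn9 : ‖(9 : ℚ_[3])‖ = 3⁻¹ ^ 2 := by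
    rw [show (9 : ℚ_[3]) = 3 ^ 2 by norm_num, norm_pow, hn3]
  have hn27 : ‖(27 : ℚ_[3])‖ = 3⁻¹ ^ 3 := by
    rw [show (27 : ℚ_[3]) = 3 ^ 3 by norm_num, norm_pow, hn3]
  -- the players in `ℚ₃`
  set s : ℚ_[3] := ((σ : ℚ) : ℚ_[3]) with hsQ
  set y : ℚ_[3] := ((Y₁ : ℚ) : ℚ_[3]) with hyQ
  set d : ℚ_[3] := ((D : ℚ) : ℚ_[3]) with hdQ
  have hs1 : ‖s‖ ≤ 1 := by rw [hsQ, hσdef]; exact hs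
  have hy1 : ‖y‖ ≤ 1 := hYn
  have hd : d = 4 * s ^ 3 - y := by rw [hdQ, hDdef]; push_cast; rfl
  have hd0 : d ≠ 0 := by rw [hdQ]; exact_mod_cast hD0
  -- goal in terms of `d`
  have hgoal : ‖(((Y₁ - 4 * (α / 3) ^ 3) / 9 : ℚ) : ℚ_[3])‖ = ‖d‖ / 3⁻¹ ^ 2 := by
    have e : (((Y₁ - 4 * (α / 3) ^ 3) / 9 : ℚ) : ℚ_[3]) = -d / 9 := by
      rw [hd, hsQ, hyQ, hσdef]; push_cast; ring
    rw [e, norm_div, norm_neg, hn9]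
  rw [hgoal, div_le_one (by positivity)]
  -- (F1) `Δ(W')` is an integer: `‖y‖ ‖d‖³ ≤ 3⁻³`
  have hF1 : ‖y‖ * ‖d‖ ^ 3 ≤ 3⁻¹ ^ 3 := by
    have hint : ‖((W'.Δ : ℚ) : ℚ_[3])‖ ≤ 1 := by
      rw [← cast_minimalDiscriminantInt W']
      have := Padic.norm_int_le_one (p := 3) W'.minimalDiscriminantInt
      exact_mod_cast this
    have e : ((W'.Δ : ℚ) : ℚ_[3]) = 16 * y * d ^ 3 / 27 := by rw [hΔ', hdQ, hyQ]; push_cast; ring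
    rw [e, norm_div, norm_mul, norm_mul, norm_pow, hn16, hn27, one_mul, div_le_one (by positivity)] at hint
    exact hint
  -- (F2) Kraus at `3` for the integral `W'`
  have hF2 := norm_c₆_eq_one_or_le_of_isGloballyMinimal W'
  have ec₆ : ((W'.c₆ : ℚ) : ℚ_[3]) = 32 * ((y + 5 * s ^ 3) ^ 2 - 27 * s ^ 6) := by rw [hc6', hsQ, hyQ]; push_cast; ring
  -- discreteness: `‖d‖ = 3^(−v)`
  by_contra hlt
  push Not at hlt
  have hdle : ‖d‖ ≤ 1 := by
    rw [hd, sub_eq_add_neg]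
    refine (Padic.nonarchimedean _ _).trans (max_le ?_ ?_)
    · rw [norm_mul, norm_pow, hn4, one_mul]; exact pow_le_one₀ (norm_nonneg _) hs1
    · rw [norm_neg]; exact hy1
  have hnd := Padic.norm_eq_zpow_neg_valuation hd0
  set v : ℤ := d.valuation with hv
  have h3r : (1 : ℝ) < 3 := by norm_num
  have hv0 : 0 ≤ v := by
    have h : ((3 : ℝ)) ^ (-v) ≤ (3 : ℝ) ^ (0 : ℤ) := by rw [zpow_zero]; exact_mod_cast hnd ▸ hdle
    have := (zpow_le_zpow_iff_right₀ h3r).mp h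
    omega
  have hv2 : v < 2 := by
    have h : (3 : ℝ) ^ (-2 : ℤ) < (3 : ℝ) ^ (-v) := by
      have e : (3 : ℝ)⁻¹ ^ 2 = (3 : ℝ) ^ (-2 : ℤ) := by norm_num
      have h' : (3 : ℝ)⁻¹ ^ 2 < ‖d‖ := hlt
      rw [e] at h'; exact_mod_cast hnd ▸ h'
    have := (zpow_lt_zpow_iff_right₀ h3r).mp h
    omega
  have hv01 : v = 0 ∨ v = 1 := by omega
  rcases hv01 with hv' | hv'
  · -- `ord₃ D = 0`: then `27 ∣ Y₁`, and `W` descends — contradiction with its minimality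
    have hdn : ‖d‖ = 1 := by have := hnd; rw [hv', neg_zero, zpow_zero] at this; exact_mod_cast this
    have hy27 : ‖y‖ ≤ 3⁻¹ ^ 3 := by simpa [hdn] using hF1
    -- `E♮ = C₀ • W`
    have hsm : shortModel W 1 = (⟨0, 0, 0, -W.c₄ / 48, -W.c₆ / 864⟩ : WeierstrassCurve ℚ) := by
      ext <;> simp [shortModel] <;> ring
    have hE4 : (shortModel W 1).c₄ = ((1 : ℚ) ^ 4)⁻¹ * W.c₄ := by
      rw [hsm]; simp only [WeierstrassCurve.c₄, WeierstrassCurve.b₂, WeierstrassCurve.b₄]; ring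
    have hE6 : (shortModel W 1).c₆ = ((1 : ℚ) ^ 6)⁻¹ * W.c₆ := by
      rw [hsm]; simp only [WeierstrassCurve.c₆, WeierstrassCurve.b₂, WeierstrassCurve.b₄, WeierstrassCurve.b₆]; ring
    obtain ⟨C₀, hC₀⟩ := exists_variableChange_of_c₄_eq_of_c₆_eq (W₁ := W) (W₂ := shortModel W 1) (w := 1)
      one_ne_zero hE4 hE6
    have hΔE : (shortModel W 1).Δ = W.Δ := by
      have h1 := (shortModel W 1).c_relation
      have h2 := W.c_relation
      rw [hE4, hE6] at h1
      linear_combination (h1 - h2) / 1728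
    have hΔW : W.Δ ≠ 0 := by rw [← WeierstrassCurve.coe_Δ']; exact W.Δ'.ne_zero
    have hu12 : ((C₀.u⁻¹ : ℚˣ) : ℚ) ^ 12 = 1 := by
      have h : (C₀ • W).Δ = ((C₀.u⁻¹ : ℚˣ) : ℚ) ^ 12 * W.Δ := by rw [variableChange_Δ]
      rw [hC₀, hΔE] at h
      exact (mul_left_eq_self₀.mp h.symm).resolve_right hΔW
    -- the `u = 3` chart `⟨3; X₁, α, Y₁⟩ • E♮ = [2σ, 0, 2Y₁/27, 0, 0]`
    have ha4E : (shortModel W 1).a₄ = -(W.c₄ / 48) := by simp [shortModel]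
    have ha6E : (shortModel W 1).a₆ = -(W.c₆ / 864) := by simp [shortModel]
    have h2α : α * (2 * Y₁) = 3 * X₁ ^ 2 + (shortModel W 1).a₄ := by
      rw [hαdef, tangentSlope, div_mul_cancel₀ _ (mul_ne_zero two_ne_zero hY0)]
    set C₃ : VariableChange ℚ := ⟨Units.mk0 (3 : ℚ) three_ne_zero, X₁, α, Y₁⟩ with hC₃
    have hu₃ : ((C₃.u⁻¹ : ℚˣ) : ℚ) = (3 : ℚ)⁻¹ := by rw [Units.val_inv_eq_inv_val, hC₃, Units.val_mk0]
    have hCW : (C₃ * C₀) • W = C₃ • shortModel W 1 := by rw [mul_smul, hC₀]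
    have hE1 : (shortModel W 1).a₁ = 0 := by simp [shortModel]
    have hE2 : (shortModel W 1).a₂ = 0 := by simp [shortModel]
    have hE3 : (shortModel W 1).a₃ = 0 := by simp [shortModel]
    have h₁' : ((C₃ * C₀) • W).a₁ = 2 * σ := by
      rw [hCW, variableChange_a₁, hu₃, hE1]; simp only [hC₃]; rw [hα]; ring
    have h₂' : ((C₃ * C₀) • W).a₂ = 0 := by
      rw [hCW, variableChange_a₂, hu₃, hE1, hE2]; simp only [hC₃]
      have h : α ^ 2 = 3 * X₁ := hflex
      linear_combination (-(1 : ℚ) / 9) * h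
    have h₃' : ((C₃ * C₀) • W).a₃ = 2 * Y₁ / 27 := by
      rw [hCW, variableChange_a₃, hu₃, hE1, hE3]; simp only [hC₃]; ring
    have h₄' : ((C₃ * C₀) • W).a₄ = 0 := by
      rw [hCW, variableChange_a₄, hu₃, hE1, hE2, hE3]; simp only [hC₃]
      linear_combination (-(1 : ℚ) / 81) * h2α
    have h₆' : ((C₃ * C₀) • W).a₆ = 0 := by
      rw [hCW, variableChange_a₆, hu₃, hE1, hE2, hE3]; simp only [hC₃]
      have h : Y₁ ^ 2 = X₁ ^ 3 + (shortModel W 1).a₄ * X₁ + (shortModel W 1).a₆ := by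
        have := heq; rw [ha4E, ha6E] at this ⊢; linear_combination this
      linear_combination (-(1 : ℚ) / 729) * h
    have hle := padicValInt_minimalDiscriminantInt_le_padicValRat_Δ_smul_of_norm_le_one W (C₃ * C₀) 3
      (by
        rw [h₁']
        have e : ((2 * σ : ℚ) : ℚ_[3]) = 2 * s := by rw [hsQ]; push_cast; ring
        rw [e, norm_mul, hn2, one_mul]; exact hs1)
      (by rw [h₂']; simp)
      (by
        rw [h₃']
        have e : ((2 * Y₁ / 27 : ℚ) : ℚ_[3]) = 2 * y / 27 := by rw [hyQ]; push_cast; ring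
        rw [e, norm_div, norm_mul, hn2, hn27, one_mul, div_le_one (by positivity)]
        exact hy27)
      (by rw [h₄']; simp)
      (by rw [h₆']; simp)
    have hΔ' : ((C₃ * C₀) • W).Δ = (3 : ℚ)⁻¹ ^ 12 * (W.minimalDiscriminantInt : ℚ) := by
      rw [hCW, variableChange_Δ, hu₃, hΔE, cast_minimalDiscriminantInt]
    have hm : (W.minimalDiscriminantInt : ℚ) ≠ 0 := by exact_mod_cast minimalDiscriminantInt_ne_zero W
    rw [hΔ', padicValRat.mul (pow_ne_zero _ (inv_ne_zero three_ne_zero)) hm, padicValRat.pow,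
      padicValRat.inv, padicValRat.of_int] at hle
    have h3v : padicValRat 3 (3 : ℚ) = 1 := by exact_mod_cast padicValRat.self (p := 3) (by norm_num)
    rw [h3v] at hle
    push_cast at hle
    linarith
  · -- `ord₃ D = 1`: then `ord₃ c₆(W') = 2`, forbidden by Kraus at `3`
    have hdn : ‖d‖ = 3⁻¹ := by
      have := hnd; rw [hv'] at this
      rw [this]; norm_num
    -- `‖y + 5s³‖ = ‖9s³ − d‖ = 3⁻¹`
    have h9s : ‖(9 : ℚ_[3]) * s ^ 3‖ < ‖-d‖ := by
      rw [norm_neg, hdn, norm_mul, norm_pow, hn9]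
      have : ‖s‖ ^ 3 ≤ 1 := pow_le_one₀ (norm_nonneg _) hs1
      nlinarith [norm_nonneg s]
    have hu : ‖y + 5 * s ^ 3‖ = 3⁻¹ := by
      have e : y + 5 * s ^ 3 = 9 * s ^ 3 + -d := by rw [hd]; ring
      rw [e, Padic.add_eq_max_of_ne (ne_of_lt h9s), max_eq_right h9s.le, norm_neg, hdn]
    -- `‖(y + 5s³)² − 27s⁶‖ = 3⁻²`
    have h27s : ‖-(27 : ℚ_[3]) * s ^ 6‖ < ‖(y + 5 * s ^ 3) ^ 2‖ := by
      rw [norm_pow, hu, norm_mul, norm_neg, norm_pow, hn27]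
      have : ‖s‖ ^ 6 ≤ 1 := pow_le_one₀ (norm_nonneg _) hs1
      nlinarith [norm_nonneg s]
    have hc₆n : ‖((W'.c₆ : ℚ) : ℚ_[3])‖ = 3⁻¹ ^ 2 := by
      rw [ec₆, norm_mul, hn32, one_mul, show (y + 5 * s ^ 3) ^ 2 - 27 * s ^ 6 = (y + 5 * s ^ 3) ^ 2 + -(27 : ℚ_[3]) * s ^ 6
        by ring, Padic.add_eq_max_of_ne (ne_of_gt h27s), max_eq_left h27s.le, norm_pow, hu]
    rcases hF2 with h | h
    · rw [hc₆n] at h; norm_num at h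
    · rw [hc₆n] at h; norm_num at h

/-- **Ascends ⟹ congruent, at a datum of level `9 ∣ N`** (additive reduction at `3` makes `E♮` `3`-integral,
`norm_shortModel_le_one_of_nine_dvd`). -/
theorem norm_congruence_le_one_of_velu_three_ascends_of_nine_dvd (W : WeierstrassCurve ℚ) [W.IsElliptic]
    [W.IsGloballyMinimal] {N : ℕ} [NeZero N] (D : ModularParametrizationData W N) (h9 : 9 ∣ N) {X₁ Y₁ : ℚ}
    (hT : IsShortThreeTorsion W 1 X₁ Y₁) (W' : WeierstrassCurve ℚ) [W'.IsElliptic] [W'.IsGloballyMinimal]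
    (h4 : (3 : ℚ) ^ 4 * W'.c₄ = 1440 * X₁ ^ 2 - 9 * W.c₄)
    (h6 : (3 : ℚ) ^ 6 * W'.c₆ = 60480 * X₁ ^ 3 - 756 * W.c₄ * X₁ - 27 * W.c₆) :
    ‖(((Y₁ - 4 * (tangentSlope W 1 X₁ Y₁ / 3) ^ 3) / 9 : ℚ) : ℚ_[3])‖ ≤ 1 := by
  obtain ⟨hA, hB⟩ := norm_shortModel_le_one_of_nine_dvd W D h9
  exact norm_congruence_le_one_of_velu_three_ascends W hA hB hT W' h4 h6

/-! ## §3 Ledger corollary: a rational generator of an untripled index-`3` Shimura kernel is congruent -/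

/-- **A RATIONAL generator of an untripled index-`3` Shimura kernel is congruent.**  For the optimal `X₁(N)`-datum `D₁` and a
lattice-optimal `X₀(N)`-datum `D₀` of two isogenous globally minimal curves, `9 ∣ N`, `|c₀| = |c₁|`, `Λ₁(f) ≠ Λ₀(f)`,
`w ∈ Λ₁(f) ∖ 3Λ₀(f)`: if the kernel abscissa `℘(c₀w/3)` is the `X`-coordinate of a RATIONAL point `(X₁, Y₁)` of order `3` on
`E♮(W₀)`, then `9 ∣ Y₁ − 4σ³` (`σ = α/3`) — the Stevens curve carries the ascended pair (`velu_three_ascends_at_of_natAbs_eq`) and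
§2 applies. -/
theorem norm_congruence_le_one_of_untripled_index_three {W₁ W₀ : WeierstrassCurve ℚ} [W₁.IsElliptic]
    [W₁.IsGloballyMinimal] [W₀.IsElliptic] [W₀.IsGloballyMinimal] {N : ℕ} [NeZero N]
    (D₁ : Gamma1ParametrizationData W₁ N) (D₀ : ModularParametrizationData W₀ N) (hiso : IsIsogenous W₁ W₀)
    (h₁ : D₁.IsOptimal) (h₀ : ∀ z ∈ D₀.L.lattice, ∃ w ∈ periodLattice D₀.f, z = D₀.c * w) (h9 : 3 ^ 2 ∣ N)
    (heq : D₀.maninConstant.natAbs = D₁.maninConstant.natAbs)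
    (hΛne : periodLatticeGamma1 D₀.f ≠ periodLattice D₀.f)
    {w : ℂ} (hw : w ∈ periodLatticeGamma1 D₀.f) (hw3 : ∀ v ∈ periodLattice D₀.f, w ≠ 3 * v)
    {X₁ Y₁ : ℚ} (hT : IsShortThreeTorsion W₀ 1 X₁ Y₁) (hx : (X₁ : ℂ) = D₀.L.weierstrassP ((D₀.c : ℂ) * w / 3)) :
    ‖(((Y₁ - 4 * (tangentSlope W₀ 1 X₁ Y₁ / 3) ^ 3) / 9 : ℚ) : ℚ_[3])‖ ≤ 1 := by
  obtain ⟨q, hq, -, hA3, hB3⟩ := velu_three_ascends_at_of_natAbs_eq D₁ D₀ hiso h₁ h₀ h9 heq hΛne hw hw3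
  have hqX : q = X₁ := by exact_mod_cast hq.trans hx.symm
  subst hqX
  exact norm_congruence_le_one_of_velu_three_ascends_of_nine_dvd W₀ D₀ (by simpa using h9) hT W₁
    (by linear_combination hA3) (by linear_combination hB3)

end Summit.BirchSwinnertonDyer.BirchSwinnertonDyer.Theorems.ManinLocalTwoThree

end
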